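import Summits.Ventures.Crystal3D.Theorems.StickyWulffConstantNoReconstructionGainBilayerAnatomy
import Summits.Ventures.Crystal3D.Theorems.StickyWulffConstantNoReconstructionGainTopRowSeven
import HarnessLib

/-!
# Bilayer-confined `(111)` criminals: the middle band or a top ball with exactly EIGHT partners
# (crux `NoReconstructionGain`, stmt-Ventures-19144, line `replication-exactness`, inside `stub_noCriminal`)

HONEST FRAMING. Part of the venture `Summits/Ventures/Crystal3D` (cell `crystal3d-full`), helper `--supports` the
crux `NoReconstructionGain` (stmt-Ventures-19144, route `route-Ventures-StickyWulffConstant`), lead wulff-p1 g24.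
The sharpening of `not_isCriminal_basal_bilayer_of_noMiddle` (`…BilayerAnatomy`) by the seven-partner top row
`topRow_ramp_seven` (`…TopRowSeven`); an ANATOMY statement, not the bilayer-hollow class.  `c = √(2/3)`.

* **`not_isCriminal_basal_bilayer_of_noMiddle_eight`** — a `(111)` film over layer `k` confined below `(k+2)c`,
  with no ball strictly inside the upper middle band `((k+1)c + c/2, (k+2)c)` and no ball at height `(k+2)c` with
  EXACTLY EIGHT partners (plugs + film balls at distance `1`), is not a criminal.  Contrapositive: **every `(111)`
  criminal confined below `(k+2)√(2/3)` has a ball strictly inside the upper middle band, or a top-level ball with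
  exactly eight partners** — the two remaining slack rows of the `W = c` window (cell memo HOLLOW-g24 §6).

WHAT THIS IS NOT: «no criminal below `(k+2)c`»; rung F-C1 not moved.
-/

noncomputable section

namespace Summit.Ventures.Crystal3D.Theorems

open Summit.Ventures.Crystal3D Finset
open scoped InnerProductSpace

open scoped Classical in
/-- **Bilayer-confined criminals: middle band or an eight-partner top ball.**  Over the close-packed layer `k` of
`Λ₀` (`k√(2/3) ≤ s < (k+1)√(2/3)`), a film confined below `(k+2)√(2/3)` in which (i) no ball has height strictly
between `(k+1)√(2/3) + √(2/3)/2` and `(k+2)√(2/3)` and (ii) no ball at height `(k+2)√(2/3)` has exactly `8`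
partners is not a criminal on `H(e₃, s)`. -/
theorem not_isCriminal_basal_bilayer_of_noMiddle_eight (k : ℤ) {s : ℝ} (hs : (k : ℝ) * Real.sqrt (2 / 3) ≤ s)
    (hs' : s < ((k : ℝ) + 1) * Real.sqrt (2 / 3)) {Q : Finset (EuclideanSpace ℝ (Fin 3))}
    (hconf : ∀ q ∈ Q, q 2 ≤ ((k : ℝ) + 2) * Real.sqrt (2 / 3))
    (hnomid : ∀ q ∈ Q, q 2 ≤ ((k : ℝ) + 1) * Real.sqrt (2 / 3) + Real.sqrt (2 / 3) / 2 ∨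
      q 2 = ((k : ℝ) + 2) * Real.sqrt (2 / 3))
    (htop : ∀ q ∈ Q, q 2 = ((k : ℝ) + 2) * Real.sqrt (2 / 3) →
      (plugSet (EuclideanSpace.single 2 (1 : ℝ)) s q).ncard + (Q.filter fun y => dist q y = 1).card ≠ 8) :
    ¬ IsCriminal (EuclideanSpace.single 2 (1 : ℝ)) s Q := by
  intro hcrim
  have hQ : IsFilmOn (EuclideanSpace.single 2 (1 : ℝ)) s Q := hcrim.1
  set c : ℝ := Real.sqrt (2 / 3) with hc
  have hcpos : 0 < c := Real.sqrt_pos.2 (by norm_num)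
  set g : ℝ → ℝ := fun z => min 2 (max 0 (1 - z / c)) with hg
  have hclip : ∀ t : ℝ, min 2 (max 0 (1 - t)) + min 2 (max 0 (1 + t)) = 2 := by
    intro t
    simp only [min_def, max_def]
    split_ifs <;> linarith
  have hsym : ∀ z, g z + g (-z) = 2 := by
    intro z
    have h := hclip (z / c)
    simp only [hg, neg_div]
    rwa [sub_neg_eq_add]
  have hplug : ∀ z, z ≤ -c → g z = 2 := by
    intro z hz
    have : 2 ≤ 1 - z / c := by
      have : z / c ≤ -1 := by rw [div_le_iff₀ hcpos]; linarith
      linarith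
    simp only [hg]
    rw [max_eq_right (by linarith), min_eq_left this]
  refine not_isCriminal_basal_of_rows_card k hs hs' hsym hplug (fun q hq N hN1 hN2 hN3 hNc => ?_) hcrim
  have hqlo := le_height_of_isFilmOn_basal k hs hQ hq
  set a : ℝ := ((k : ℝ) + 1) * c - q 2 with ha
  have ha0 : a ≤ 0 := by rw [ha]; linarith
  have hwin : ∀ u ∈ N, u 2 = a - c ∨ (a ≤ u 2 ∧ u 2 ≤ a + c) := by
    intro u hu
    rcases hN3 u hu with h | ⟨x, hx, h⟩
    · left; rw [h, ha]; ring
    · right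
      have hxlo := le_height_of_isFilmOn_basal k hs hQ hx
      have hxhi := hconf x hx
      rw [h, ha]; constructor <;> linarith
  rcases hnomid q hq with hlow | htopq
  · have haW : -(c / 2) ≤ a := by rw [ha]; linarith
    exact confinedRow_ramp_of_neg_half_le haW ha0 N hN1 hN2 hwin
  · have hac : a = -c := by rw [ha, htopq]; ring
    have hwin' : ∀ u ∈ N, u 2 = -c - c ∨ (-c ≤ u 2 ∧ u 2 ≤ -c + c) := by
      intro u hu; have := hwin u hu; rwa [hac] at this
    by_cases h7 : N.card = 7
    · exact topRow_ramp_seven N hN1 hN2 hwin' h7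
    · have h8 : N.card ≠ 8 := by rw [hNc]; exact htop q hq htopq
      exact topRow_ramp_of_card_ne N hN1 hN2 hwin' h7 h8

end Summit.Ventures.Crystal3D.Theorems

end
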